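import Literature.MathematicalPhysics.QuantumFieldTheory.Balaban1983to89.B9SectCDiffCutModelToy16

/-!
# `Balaban1983to89.B9SectCDiffCutModelToy17` — THE FULL PROPAGATORS OF THE TWO SEQUENCES DIFFER: `G_v,toy ≠ Gtoy`
# (the `G`-level honesty item left open by Toy15/Toy16; purely algebraic) — TOY, OURS

CITATION HEADER (LEAF RULE: no quotation in this file; pointers BY NAME only).  The published setting is the one
quoted verbatim in the headers of `…B9SectCDiffEstimate` / `…B9SectCDiffExpansion` / `…B9SectCDiffCutModel`
(Balaban, *Commun. Math. Phys.* **99** (1985) 389–434, §C, (3.97)–(3.102)); this file adds nothing from print.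
Tree inputs, by name: `B9SectCDiffCutModelToy4.{ι, ι_eq, Sh_apply, Dfw, Dbw, Dbw_eq_transpose, sstep, h4, h4_eq}`,
`B9SectCDiffCutModelToy.{ramp_eq_of_mem, Qp}`, `B9SectCDiffCutModelToy2.Qpt`, `B9SectCDiffCutModelToy5.{Gr,
Gr_nonneg, Hm, Hm_mul_Gr}`, `B9SectCDiffCutModelToy6.E2`, `B9SectCDiffCutModelToy7.isUnit_E2_num`,
`B9SectCDiffCutModelToy8.{Lam, Gtoy, Gtoy_mul_eq_one_num, E2inv_hC_shape}`, `B9SectCDiffCutModelToy10.muB_pos`,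
`B9SectCDiffCutModelToy11.{Hv, Gv, Hv_mul_Gv, Ev, Gtoyv, Gtoyv_mul_eq_one_num, isUnit_Ev_num, ha20_of, haB_of}`,
`B9SectCDiffCutModelToy12.{Dfw_apply_self, hBnat_of}`, `B9SectCDiffCutModelToy15.{Xhv, Xsh, vsh, vsh_nonneg,
vsh_le, vsh_eq_zero_of_h4_ne_zero, vsh_base_ne_zero, Xsh_G'₂_ne_G'₁, Xsh_A'₂_ne_A'₁}`,
`B9SectCDiffCutModelToy16.{Gr_pos, Xsh_Ev_lt_E2}`; Mathlib's `Matrix.det_of_upperTriangular`,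
`Matrix.det_reindex_self`, `finProdFinEquiv`, `mul_eq_one_comm`, `Matrix.inv_inj`.

WHAT THIS MODULE DOES (census `SectC-inst-census.md` note N21b (2) — the `G`-LEVEL honesty item; TOY).  Toy15's
datum `Xhv` carries two FULL propagators, the Woodbury forms `G₁ = Gtoy = G₀ + G₀·(∂G′Q′*)·M_C⁻¹·(Q′G′∂*)·G₀` and
`G₂ = G_v,toy` (the same with `G_v`, `E_v`, `M_C,v`); they contain the differences `∂`, `∂*`, have entries of
both signs, and no order relation between them is available (Toy16's header, caveat (1)).  This file proves
that they are nevertheless DIFFERENT, by algebra alone: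
* §1 **`∂ = S − 1` IS INVERTIBLE**: reindexed along the linear index `ι` (`finProdFinEquiv`) it is upper
  triangular with diagonal `−1`, so `det ∂ = (−1)^(n·B)` (`det_Dfw`), `det ∂* = (−1)^(n·B)` (`det_Dbw`); left
  cancellation of `∂` and right cancellation of `∂*` (`Dfw_left_cancel`, `Dbw_right_cancel`).
* §2 **TWO RIGHT INVERSES OF ONE MATRIX COINCIDE** (`op_eq_of_mul_eq_one`, Dedekind-finiteness of square
  matrices); the entries of `Q′*·Y` (`Qpt_mul_apply`: constant on blocks) and `(G′Q′*)(x, block of x) > 0`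
  (`GrQpt_pos`, from Toy16's `Gr_pos`).
* §3 **`G_v,toy ≠ Gtoy`** (`Gtoyv_ne_Gtoy`) whenever ONE block contains a site `x₀` with `v(x₀) ≠ 0` and a site
  `x₁` with `v(x₁) = 0` (`2²⁴ ≤ a`, `2a ≤ B`, `0 ≤ v ≤ 3(a/B)²`).  PROOF: if `G_v,toy = Gtoy` then the two
  `hG`-identities `Gtoy·K₁ = 1` (`Gtoy_mul_eq_one_num`) and `G_v,toy·K₂ = 1` (`Gtoyv_mul_eq_one_num`) give
  `K₁ = K₂`, i.e. `∂(1 − Π₁)∂* = ∂(1 − Π₂)∂*` with `Π₁ = G′Q′*E₂⁻¹Q′G′`, `Π₂ = G_vQ′*E_v⁻¹Q′G_v`; cancelling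
  `∂`, `∂*`: `Π₁ = Π₂`.  `Π₁` fixes `G′Q′*` (`E₂⁻¹·Q′G′G′Q′* = 1`, Toy8's `E2inv_hC_shape`), hence so does
  `Π₂`; multiplying `Π₂·G′Q′* = G′Q′*` on the left by `H_v = H + diag v` (`H_vG_v = 1`, `HG′ = 1`) gives
  `Q′* + diag(v)·G′Q′* = Q′*·Y` for a coarse matrix `Y`: the columns of `diag(v)·G′Q′*` are CONSTANT ON BLOCKS.
  Reading the column of the block of `x₀` at the sites `x₀`, `x₁`: `v(x₀)·(G′Q′*)(x₀, ·) = v(x₁)·(G′Q′*)(x₁, ·)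
  = 0`, contradicting `v(x₀) ≠ 0` and `(G′Q′*)(x₀, block x₀) > 0`.
* §4 **FOR TOY15's SHADOW DATUM `Xsh`**: the sites `x₀ = (I₀, 0)` (`vsh = 3(a/B)² ≠ 0`, Toy15) and `x₁ = (I₀, 1)`
  (`vsh = 0` because `h₄(x₁) = f(1/(M·B)) > 0`: `sstep_pos`, `h4_base_succ_pos`; needs `B ≥ 2`, automatic) lie
  in block `I₀`, so **`G₂ ≠ G₁`** (`Xsh_G₂_ne_G₁`); also `C₂ = E_v⁻¹ ≠ E₂⁻¹ = C₁` (`Xsh_C₂_ne_C₁`, from Toy16's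
  `Xsh_Ev_lt_E2`).  SUMMARY `Xsh_all_slots_differ`: the two operator sequences of the shadow datum differ in
  EVERY primary slot — `G′₂ ≠ G′₁`, `A′₂ ≠ A′₁`, `C₂ ≠ C₁`, `G₂ ≠ G₁`.

HONEST CAVEATS.  (1) The COMPRESSED quantities are still not separated: `T₂ ≠ T₁` (`T = Q·G·Q*`, a block
average) and the headline defect `𝔇(T) ≠ 0` of Toy15 do NOT follow from `G₂ ≠ G₁` and are NOT certified here or
anywhere; there is no order structure to force them (differences of orthogonal projections are indefinite), so a
certificate would have to be an explicit computation.  (2) Qualitative (`≠`) only.  (3) TOY: `d = 1`, one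
renormalisation level — NOT summit progress.  Every declaration carries a docstring + `[folklore]` tag; no
`sorry`; no `instance`; no `HarnessLib` fact; standard axioms only.  v1.1 (docstring-only, XREAD verdict of v1: DOCFIX D1 +
INFO I1): header pointers `Qp` re-addressed to `B9SectCDiffCutModelToy` (it is not a `…Toy2` name), `Toy4.h4` and `Toy5.Hm`
added to the pointer list; declarations and proofs byte-identical to v1.
-/

namespace Literature.MathematicalPhysics.QuantumFieldTheory.Balaban1983to89.B9SectCDiffCutModelToy17

open Finset Real
open B9SectCDiffCutModelToy
open B9SectCDiffCutModelToy2
open B9SectCDiffCutModelToy4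
open B9SectCDiffCutModelToy5
open B9SectCDiffCutModelToy6
open B9SectCDiffCutModelToy7
open B9SectCDiffCutModelToy8
open B9SectCDiffCutModelToy10
open B9SectCDiffCutModelToy11
open B9SectCDiffCutModelToy12
open B9SectCDiffCutModelToy15
open B9SectCDiffCutModelToy16

noncomputable section

/-! ## §1 `∂ = S − 1` is invertible -/

section DfwSec

variable {n B : ℕ}

/-- the entries of `∂ = S − 1`: `∂(x, y) = [ι y = ι x + 1] − [x = y]`. [folklore] -/
theorem Dfw_apply (x y : Fin n × Fin B) :
    Dfw n B x y = (if ι y = ι x + 1 then (1 : ℝ) else 0) - (if x = y then 1 else 0) := by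
  unfold Dfw; rw [Matrix.sub_apply, Sh_apply, Matrix.one_apply]

/-- the linear index of the site with `finProdFinEquiv`-index `i` is `i`. [folklore] -/
theorem ι_symm_apply (i : Fin (n * B)) : ι (finProdFinEquiv.symm i : Fin n × Fin B) = i.val := by
  unfold ι; rw [Equiv.apply_symm_apply]

/-- `∂`, reindexed along the linear index, is UPPER TRIANGULAR. [folklore] -/
theorem Dfw_reindex_blockTriangular :
    (Matrix.reindex finProdFinEquiv finProdFinEquiv (Dfw n B)).BlockTriangular id := by
  intro i j hij
  have hlt : j.val < i.val := hij
  rw [Matrix.reindex_apply, Matrix.submatrix_apply, Dfw_apply]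
  have h1 : ¬ (ι (finProdFinEquiv.symm j : Fin n × Fin B) = ι (finProdFinEquiv.symm i : Fin n × Fin B) + 1) := by
    rw [ι_symm_apply, ι_symm_apply]; omega
  have h2 : ¬ ((finProdFinEquiv.symm i : Fin n × Fin B) = finProdFinEquiv.symm j) := by
    intro h
    have h' := congrArg (ι : Fin n × Fin B → ℕ) h
    rw [ι_symm_apply, ι_symm_apply] at h'
    omega
  rw [if_neg h1, if_neg h2, sub_zero]

/-- **`det ∂ = (−1)^(n·B)`** (upper triangular with diagonal `−1` after reindexing). [folklore] -/
theorem det_Dfw : (Dfw n B).det = (-1) ^ (n * B) := by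
  rw [← Matrix.det_reindex_self finProdFinEquiv (Dfw n B),
    Matrix.det_of_upperTriangular Dfw_reindex_blockTriangular]
  simp only [Matrix.reindex_apply, Matrix.submatrix_apply, Dfw_apply_self]
  rw [Finset.prod_const, Finset.card_univ, Fintype.card_fin]

/-- `det ∂* = (−1)^(n·B)` (`∂* = ∂ᵀ`). [folklore] -/
theorem det_Dbw : (Dbw n B).det = (-1) ^ (n * B) := by
  rw [Dbw_eq_transpose, Matrix.det_transpose, det_Dfw]

/-- `det ∂` is a unit. [folklore] -/
theorem isUnit_det_Dfw : IsUnit (Dfw n B).det := by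
  rw [det_Dfw]; exact isUnit_iff_ne_zero.mpr (pow_ne_zero _ (by norm_num))

/-- `det ∂*` is a unit. [folklore] -/
theorem isUnit_det_Dbw : IsUnit (Dbw n B).det := by
  rw [det_Dbw]; exact isUnit_iff_ne_zero.mpr (pow_ne_zero _ (by norm_num))

/-- **LEFT CANCELLATION OF `∂`**: `∂X = ∂Y ⇒ X = Y`. [folklore] -/
theorem Dfw_left_cancel {X Y : Matrix (Fin n × Fin B) (Fin n × Fin B) ℝ}
    (h : Dfw n B * X = Dfw n B * Y) : X = Y := by
  have h' := congrArg (fun Z => (Dfw n B)⁻¹ * Z) h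
  simpa only [← Matrix.mul_assoc, Matrix.nonsing_inv_mul _ isUnit_det_Dfw, Matrix.one_mul] using h'

/-- **RIGHT CANCELLATION OF `∂*`**: `X∂* = Y∂* ⇒ X = Y`. [folklore] -/
theorem Dbw_right_cancel {X Y : Matrix (Fin n × Fin B) (Fin n × Fin B) ℝ}
    (h : X * Dbw n B = Y * Dbw n B) : X = Y := by
  have h' := congrArg (fun Z => Z * (Dbw n B)⁻¹) h
  simpa only [Matrix.mul_assoc, Matrix.mul_nonsing_inv _ isUnit_det_Dbw, Matrix.mul_one] using h'

end DfwSec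

/-! ## §2 Small algebra: uniqueness of the inverted operator; block-constant columns; a positive entry -/

section Algebra

variable {m : Type*} [Fintype m] [DecidableEq m] {n B : ℕ} {μ : ℝ}

/-- **TWO RIGHT INVERSES OF ONE SQUARE MATRIX COINCIDE** (square matrices over `ℝ` are Dedekind-finite:
`GK₁ = 1 ⇒ K₁G = 1`). [folklore] -/
theorem op_eq_of_mul_eq_one {G K₁ K₂ : Matrix m m ℝ} (h1 : G * K₁ = 1) (h2 : G * K₂ = 1) : K₁ = K₂ := by
  have h1' : K₁ * G = 1 := mul_eq_one_comm.mp h1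
  calc K₁ = K₁ * (G * K₂) := by rw [h2, Matrix.mul_one]
    _ = K₁ * G * K₂ := by rw [Matrix.mul_assoc]
    _ = K₂ := by rw [h1', Matrix.one_mul]

/-- the entries of `Q′*·Y` for a coarse matrix `Y`: `(Q′*Y)(x, J) = Y(block of x, J)` — CONSTANT ON BLOCKS.
[folklore] -/
theorem Qpt_mul_apply (Y : Matrix (Fin n) (Fin n) ℝ) (x : Fin n × Fin B) (J : Fin n) :
    (Qpt n B * Y) x J = Y x.1 J := by
  rw [Matrix.mul_apply]
  have h : ∀ I : Fin n, Qpt n B x I * Y I J = if x.1 = I then Y I J else 0 := fun I => by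
    have e : Qpt n B x I = if x.1 = I then (1 : ℝ) else 0 := rfl
    rw [e]; split_ifs <;> simp
  simp_rw [h]
  rw [Finset.sum_ite_eq]; simp

/-- `(G′Q′*)(x, block of x) > 0` on the toy line (`μ > 0`; Toy16's `Gr_pos`). [folklore] -/
theorem GrQpt_pos (hμ : 0 < μ) (x : Fin n × Fin B) : 0 < (Gr n B μ * Qpt n B) x x.1 := by
  rw [Matrix.mul_apply]
  have e : ∀ z : Fin n × Fin B, Qpt n B z x.1 = if z.1 = x.1 then (1 : ℝ) else 0 := fun z => rfl
  calc (0 : ℝ) < Gr n B μ x x * Qpt n B x x.1 := by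
        rw [e, if_pos rfl, mul_one]; exact Gr_pos hμ x x
    _ ≤ ∑ z, Gr n B μ x z * Qpt n B z x.1 :=
      Finset.single_le_sum (f := fun z => Gr n B μ x z * Qpt n B z x.1)
        (fun z _ => mul_nonneg (Gr_nonneg hμ x z) (by rw [e]; split_ifs <;> norm_num)) (Finset.mem_univ x)

end Algebra

/-! ## §3 The full propagators of the two sequences differ -/

section Main

variable {n B : ℕ} {a : ℝ} {v : Fin n × Fin B → ℝ}

/-- **`G_v,toy ≠ Gtoy`** as soon as one block contains a site `x₀` with `v(x₀) ≠ 0` and a site `x₁` with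
`v(x₁) = 0` (`2²⁴ ≤ a`, `2a ≤ B`, `0 ≤ v ≤ 3(a/B)²`; fine mass `μ = ν = (a/B)²`).  Equal propagators ⇒ equal
inverted operators ⇒ (cancel `∂`, `∂*`) equal averaging projections `Π₁ = Π₂` ⇒ `Π₂` fixes `G′Q′*` ⇒ (`× H_v`)
`diag(v)·G′Q′*` has block-constant columns ⇒ `v(x₀)·(G′Q′*)(x₀, block x₀) = v(x₁)·(G′Q′*)(x₁, block x₀) = 0`,
absurd. [folklore] -/
theorem Gtoyv_ne_Gtoy (ha : 16777216 ≤ a) (haB : 2 * a ≤ (B : ℝ)) (hv0 : ∀ x, 0 ≤ v x)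
    (hv1 : ∀ x, v x ≤ 3 * (a / B) ^ 2) {x₀ x₁ : Fin n × Fin B} (hblk : x₁.1 = x₀.1) (h0 : v x₀ ≠ 0)
    (h1 : v x₁ = 0) :
    Gtoyv n B ((a / B) ^ 2) ((a / B) ^ 2) v ≠ Gtoy n B ((a / B) ^ 2) ((a / B) ^ 2) := by
  intro hEq
  have hμ : 0 < (a / B) ^ 2 := muB_pos (ha20_of ha) (haB_of ha haB)
  have hE : IsUnit (E2 n B ((a / B) ^ 2)) := (isUnit_E2_num (by linarith) (haB_of ha haB)).1
  -- (1) equal propagators ⇒ equal inverted operators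
  have k1 := Gtoy_mul_eq_one_num (n := n) (B := B) (ha20_of ha) (haB_of ha haB)
  have k2 := Gtoyv_mul_eq_one_num (n := n) ha haB hv0 hv1
  rw [hEq] at k2
  have hK := op_eq_of_mul_eq_one k1 k2
  -- (2) cancel `Λ + 0`, then `∂` on the left and `∂*` on the right: `Π₁ = Π₂`
  have hA := add_left_cancel hK
  simp only [Matrix.mul_assoc] at hA
  have hP := sub_right_inj.mp (Dbw_right_cancel (Dfw_left_cancel hA))
  -- (3) `Π₁` fixes `G′Q′*`, hence so does `Π₂`
  have hC : (E2 n B ((a / B) ^ 2))⁻¹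
      * (Qp n B * (Gr n B ((a / B) ^ 2) * (Gr n B ((a / B) ^ 2) * Qpt n B))) = 1 := by
    simpa only [Matrix.mul_assoc] using E2inv_hC_shape hE
  have hfix := congrArg (fun Z => Z * (Gr n B ((a / B) ^ 2) * Qpt n B)) hP
  simp only [Matrix.mul_assoc] at hfix
  rw [hC, Matrix.mul_one] at hfix
  -- hfix : G′Q′* = G_v (Q′* (E_v⁻¹ (Q′ (G_v (G′ Q′*)))))
  -- (4) multiply by `H_v = H + diag v` on the left
  have hH := congrArg (fun Z => Hv n B ((a / B) ^ 2) v * Z) hfix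
  rw [← Matrix.mul_assoc (Hv n B ((a / B) ^ 2) v) (Gv n B ((a / B) ^ 2) v), Hv_mul_Gv hμ hv0,
    Matrix.one_mul, show Hv n B ((a / B) ^ 2) v = Hm n B ((a / B) ^ 2) + Matrix.diagonal v from rfl,
    Matrix.add_mul, ← Matrix.mul_assoc (Hm n B ((a / B) ^ 2)) (Gr n B ((a / B) ^ 2)) (Qpt n B),
    Hm_mul_Gr hμ, Matrix.one_mul] at hH
  -- hH : Q′* + diag v · (G′Q′*) = Q′* · Y
  -- (5) read the column `block x₀` at the sites `x₀`, `x₁`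
  have e0 := congrFun (congrFun hH x₀) x₀.1
  have e1 := congrFun (congrFun hH x₁) x₀.1
  rw [Matrix.add_apply, Matrix.diagonal_mul, Qpt_mul_apply] at e0 e1
  have q0 : Qpt n B x₀ x₀.1 = 1 := if_pos rfl
  have q1 : Qpt n B x₁ x₀.1 = 1 := if_pos hblk
  rw [q0] at e0
  rw [q1, h1, zero_mul, add_zero, hblk] at e1
  have hz : v x₀ * (Gr n B ((a / B) ^ 2) * Qpt n B) x₀ x₀.1 = 0 := by linarith
  exact mul_ne_zero h0 (GrQpt_pos hμ x₀).ne' hz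

end Main

/-! ## §4 The shadow datum: `G₂ ≠ G₁`, `C₂ ≠ C₁`, all four primary slots differ -/

section Shadow

variable {n B M I₀ : ℕ} {a : ℝ} {ha : 16777216 ≤ a} {haB : 2 * a ≤ (B : ℝ)}

/-- `2²⁴ ≤ a`, `2a ≤ B ⇒ 1 < B` (a block has at least two sites). [folklore] -/
theorem one_lt_B (ha : 16777216 ≤ a) (haB : 2 * a ≤ (B : ℝ)) : 1 < B := by
  have h : (1 : ℝ) < B := by linarith
  exact_mod_cast h

/-- the smoothstep is STRICTLY positive on `(0, 1]`: `f(r) = r²(3 − 2r) > 0`. [folklore] -/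
theorem sstep_pos {r : ℝ} (h0 : 0 < r) (h1 : r ≤ 1) : 0 < sstep r := by
  unfold sstep
  nlinarith [mul_pos (pow_pos h0 2) (by linarith : (0 : ℝ) < 3 - 2 * r)]

/-- `h₄ > 0` at the site `(I₀, 1)` next to the base of the ramp: `h₄(I₀, 1) = f(1/(M·B))`. [folklore] -/
theorem h4_base_succ_pos (hB : 1 < B) (hM : 0 < M) (hI₀ : I₀ < n) :
    0 < h4 n B M I₀ ((⟨I₀, hI₀⟩ : Fin n), (⟨1, hB⟩ : Fin B)) := by
  have hB0 : 0 < B := by omega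
  have hBr : (1 : ℝ) < B := by exact_mod_cast hB
  have hMr : (1 : ℝ) ≤ M := by exact_mod_cast hM
  have hMB : (1 : ℝ) ≤ (M : ℝ) * B := by nlinarith
  have hι : ((ι (((⟨I₀, hI₀⟩ : Fin n), (⟨1, hB⟩ : Fin B))) : ℕ) : ℝ) = (I₀ : ℝ) * B + 1 := by
    rw [ι_eq]; push_cast; ring
  rw [h4_eq, hι, ramp_eq_of_mem hB0 hM (by linarith) (by linarith)]
  have hr : ((I₀ : ℝ) * B + 1 - I₀ * B) / (M * B) = 1 / (M * B) := by ring
  rw [hr]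
  exact sstep_pos (by positivity) (by rw [div_le_one (by positivity)]; exact hMB)

/-- the shadow potential VANISHES at `(I₀, 1)` (`h₄ ≠ 0` there). [folklore] -/
theorem vsh_base_succ_eq_zero (hB : 1 < B) (hM : 0 < M) (hI₀ : I₀ < n) :
    vsh n B M I₀ a ((⟨I₀, hI₀⟩ : Fin n), (⟨1, hB⟩ : Fin B)) = 0 :=
  vsh_eq_zero_of_h4_ne_zero (h4_base_succ_pos hB hM hI₀).ne'

/-- **THE FULL PROPAGATORS OF THE SHADOW DATUM DIFFER: `G₂ = G_vsh,toy ≠ Gtoy = G₁`** (`0 < M`, `I₀ < n`; the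
witness block is `I₀` with the sites `(I₀, 0)`, `(I₀, 1)`). [folklore] -/
theorem Xsh_G₂_ne_G₁ (hM : 0 < M) (hI₀ : I₀ < n) :
    (Xsh n B M I₀ a ha haB).G₂ ≠ (Xsh n B M I₀ a ha haB).G₁ := by
  have ha0 : 0 < a := by linarith
  show Gtoyv n B ((a / B) ^ 2) ((a / B) ^ 2) (vsh n B M I₀ a) ≠ Gtoy n B ((a / B) ^ 2) ((a / B) ^ 2)
  exact Gtoyv_ne_Gtoy ha haB vsh_nonneg vsh_le
    (x₀ := ((⟨I₀, hI₀⟩ : Fin n), (⟨0, hBnat_of ha haB⟩ : Fin B)))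
    (x₁ := ((⟨I₀, hI₀⟩ : Fin n), (⟨1, one_lt_B ha haB⟩ : Fin B))) rfl
    (vsh_base_ne_zero (hBnat_of ha haB) hM hI₀ ha0) (vsh_base_succ_eq_zero (one_lt_B ha haB) hM hI₀)

/-- **THE COARSE INVERSES DIFFER: `C₂ = E_vsh⁻¹ ≠ E₂⁻¹ = C₁`** (Toy16's `Xsh_Ev_lt_E2` and `Matrix.inv_inj`).
[folklore] -/
theorem Xsh_C₂_ne_C₁ (hM : 0 < M) (hI₀ : I₀ < n) :
    (Xsh n B M I₀ a ha haB).C₂ ≠ (Xsh n B M I₀ a ha haB).C₁ := by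
  show (Ev n B ((a / B) ^ 2) (vsh n B M I₀ a))⁻¹ ≠ (E2 n B ((a / B) ^ 2))⁻¹
  intro h
  have hU : IsUnit (Ev n B ((a / B) ^ 2) (vsh n B M I₀ a)).det :=
    (Matrix.isUnit_iff_isUnit_det _).mp (isUnit_Ev_num ha haB vsh_nonneg vsh_le).1
  have hEq : Ev n B ((a / B) ^ 2) (vsh n B M I₀ a) = E2 n B ((a / B) ^ 2) := Matrix.inv_inj h hU
  have hlt := Xsh_Ev_lt_E2 (n := n) (B := B) (M := M) (I₀ := I₀) ha haB hM hI₀ ⟨I₀, hI₀⟩ ⟨I₀, hI₀⟩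
  rw [hEq] at hlt
  exact lt_irrefl _ hlt

/-- **SUMMARY — THE TWO OPERATOR SEQUENCES OF THE SHADOW DATUM DIFFER IN EVERY PRIMARY SLOT**: `G′₂ ≠ G′₁`,
`A′₂ ≠ A′₁` (Toy15), `C₂ ≠ C₁`, `G₂ ≠ G₁` (this file). [folklore] -/
theorem Xsh_all_slots_differ (hM : 0 < M) (hI₀ : I₀ < n) :
    (Xsh n B M I₀ a ha haB).G'₂ ≠ (Xsh n B M I₀ a ha haB).G'₁
      ∧ (Xsh n B M I₀ a ha haB).A'₂ ≠ (Xsh n B M I₀ a ha haB).A'₁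
      ∧ (Xsh n B M I₀ a ha haB).C₂ ≠ (Xsh n B M I₀ a ha haB).C₁
      ∧ (Xsh n B M I₀ a ha haB).G₂ ≠ (Xsh n B M I₀ a ha haB).G₁ :=
  ⟨Xsh_G'₂_ne_G'₁ hM hI₀, Xsh_A'₂_ne_A'₁ hM hI₀, Xsh_C₂_ne_C₁ hM hI₀, Xsh_G₂_ne_G₁ hM hI₀⟩

end Shadow

end

end Literature.MathematicalPhysics.QuantumFieldTheory.Balaban1983to89.B9SectCDiffCutModelToy17
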